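import Summits.ResolutionOfSingularities.ResolutionOfSingularities.Theorems.WeightedInvariantIotaOrdEpsTauUpperSemicontinuousAllDim
import Summits.ResolutionOfSingularities.ResolutionOfSingularities.Theorems.WeightedInvariantIotaCylinderUpperSemicontinuousOnLE
import Summits.ResolutionOfSingularities.ResolutionOfSingularities.Theorems.WeightedInvariantHypersurfaceLocalGameEFT4SDimLEDoorGraded
import Summits.ResolutionOfSingularities.ResolutionOfSingularities.Theorems.WeightedInvariantKeyRungThreeOfDescent
import Literature.AlgebraicGeometry.Resolution.ExcellentRingsFieldProofs
import HarnessLib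

/-!
# THE GRADED CLAUSE hgr OF THE P3 RUNG CLOSED: `IotaUpperSemicontinuousGradedLE 3 p Iota3.iotaFlatT`, UNCONDITIONALLY
# (door `HypersurfaceCentreConstruction`, stmt-ResolutionOfSingularities-19897; registered stub `stub_keyRungGrHomLE_three`, gap hgr)

Topic: `Summits/ResolutionOfSingularities/ResolutionOfSingularities/Theorems`. Helper for the door item `HypersurfaceCentreConstruction`
(stmt-ResolutionOfSingularities-19897, route `WeightedInvariant`), line `local-engine`, def-free.  (c8-gr)≤3: on the homogeneous spectrum of a
smooth `ℤʲ`-graded affine `k₀`-algebra `A` (perfect `k₀` of characteristic `p`; homogeneous primes with local rings of dimension `≤ 3`) the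
super-level sets of `P ↦ ι₃ᵗ(A_P, f)` are closed — for EVERY `f` (homogeneity and the grading are not used).  Proof, on the affine scheme
`Y = Spec A` (smooth, any dimension): the stratifier `ι₀ = (ν ; ε ; τ)` is upper semicontinuous on `Y` (…IotaOrdEpsTauUpperSemicontinuousAllDim:
the tie primes of `A` are finitely many, …TieFiniteGlobal); and AT EVERY POINT OF DIMENSION `≤ 3` the cylinder reading of `σ` on the stratum
`{ι₀ = a}` is the trace of the closed set `⋃ closure {x}` over the finitely many maximal points `x` of `{a ≤ ι₀}` with `ι₀(x) = a`, `b ≤ σ(x)`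
(`Iota3.exists_isClosed_cylinder_trace`, the pointwise form of …IotaCylinderUpperSemicontinuousOnLE); so `{α ≤ ι₃ᵗ}` agrees on the points of
dimension `≤ 3` — among them all homogeneous primes — with the closed set `{a + 1 ≤ ι₀} ∪ ({a ≤ ι₀} ∩ C)`, `α = ((ω+1)·ω)·a + b`.

* `Iota3.exists_nat_ringKrullDim_le` — a finite-type algebra over a field has Krull dimension `≤ d` for some `d : ℕ`;
* `Iota3.exists_isClosed_cylinder_trace` — the pointwise cylinder lemma on a smooth quasi-compact `Y` over a perfect field, any dimension;
* **`Iota3.iotaFlatT_upperSemicontinuousGradedLE_three : IotaUpperSemicontinuousGradedLE 3 p iotaFlatT`** — the gap hgr, every `p`;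
* `keyRungGrHomLE_three_of_descent'` — the gap list of `stub_keyRungGrHomLE_three` after this file: (desc-τ), `hσ`, (σ-pt), (hpt), hgame, the
  residue of the dominance word at the power positions (hc8 and hgr discharged).

[OURS · L1 W4.3 · hgr]  Replaces the role of NO printed item; NOT a statement of the manuscript under review [claim: Hironaka2017, status:
under-review]; candidates stay candidates; AI work, weaker than expert review.  No definition; no axiom.

## References

* A. Grothendieck, EGA I 1.3 (stalks of `Spec A`); EGA IV 0.2.1. [folklore]
-/

noncomputable section

set_option linter.dupNamespace false -- mandated namespace `Summit.<Summit>.<Problem>` of this single-conjunct summit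

open CategoryTheory AlgebraicGeometry TopologicalSpace IsLocalRing Topology
open Literature.AlgebraicGeometry.Resolution
open Summit.ResolutionOfSingularities.ResolutionOfSingularities.Theorems
open Summit.ResolutionOfSingularities.ResolutionOfSingularities.Theorems.ContactCylinder

namespace Summit.ResolutionOfSingularities.ResolutionOfSingularities.Cruxes.HypersurfaceCentreConstruction.LocalEngine

namespace Iota3

/-- A finite-type algebra over a field has Krull dimension `≤ d` for some natural number `d`. [folklore] -/
theorem exists_nat_ringKrullDim_le (k₀ A : Type) [Field k₀] [CommRing A] [Algebra k₀ A] [Algebra.FiniteType k₀ A] :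
    ∃ d : ℕ, ringKrullDim A ≤ d := by
  have hlt := ringKrullDim_lt_top_of_finiteType_field k₀ A
  generalize hx : ringKrullDim A = x at hlt
  induction x using WithBot.recBotCoe with
  | bot => exact ⟨0, bot_le⟩
  | coe m =>
    induction m using ENat.recTopCoe with
    | top => exact absurd hlt (lt_irrefl _)
    | coe n => exact ⟨n, le_rfl⟩

section CylinderTrace

variable (ι : (R : Type) → [CommRing R] → R → Ordinal.{0})

/-- **THE POINTWISE CYLINDER LEMMA (any dimension).**  `Y` smooth quasi-compact over a perfect field (all stalks of dimension `≤ d`), `f`, `α β`: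
there is a CLOSED `C ⊆ Y` such that at every point `y` with `dim 𝒪_{Y,y} ≤ 3`:
`ι₀(y) = α ∧ β ≤ iotaCylinder ι₀ ι (y)  ↔  ι₀(y) = α ∧ y ∈ C` — `C = ⋃ closure {x}` over the maximal points `x` of `{α ≤ ι₀}` with `ι₀(x) = α`,
`β ≤ ι(𝒪_{Y,x}, f_x)` (the proof of `iotaCylinder_upperSemicontinuousOnLE_three`, localised at the points of dimension `≤ 3`). [OURS] -/
theorem exists_isClosed_cylinder_trace (hiso : IotaIsoInvariant ι) {p d : ℕ} {k₀ : Type} [Field k₀] [CharP k₀ p] [PerfectField k₀]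
    {Y : Scheme.{0}} (hY : Y ⟶ Spec (CommRingCat.of k₀)) [Smooth hY] [QuasiCompact hY]
    (hd : ∀ y : Y, ringKrullDim (Y.presheaf.stalk y) ≤ d) (f : Γ(Y, ⊤)) (α β : Ordinal.{0}) :
    ∃ C : Set Y, IsClosed C ∧ ∀ y : Y, ringKrullDim (Y.presheaf.stalk y) ≤ 3 →
      ((iotaOrdEpsTau (Y.presheaf.stalk y) ((Y.presheaf.germ ⊤ y trivial) f) = α ∧
          β ≤ iotaCylinder iotaOrdEpsTau ι (Y.presheaf.stalk y) ((Y.presheaf.germ ⊤ y trivial) f)) ↔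
        (iotaOrdEpsTau (Y.presheaf.stalk y) ((Y.presheaf.germ ⊤ y trivial) f) = α ∧ y ∈ C)) := by
  classical
  haveI : NoetherianSpace Y := Theorems.noetherianSpace_of_smooth_quasiCompact hY
  set ν₀ : Y → Ordinal.{0} := fun y => iotaOrdEpsTau (Y.presheaf.stalk y) ((Y.presheaf.germ ⊤ y trivial) f) with hν₀
  set ρ : Y → Ordinal.{0} := fun y => ι (Y.presheaf.stalk y) ((Y.presheaf.germ ⊤ y trivial) f) with hρ
  set cyl : Y → Ordinal.{0} := fun y =>
    iotaCylinder iotaOrdEpsTau ι (Y.presheaf.stalk y) ((Y.presheaf.germ ⊤ y trivial) f) with hcyl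
  have hmono : ∀ {x y : Y}, x ⤳ y → ν₀ x ≤ ν₀ y := fun hxy => iotaOrdEpsTau_le_of_specializes hY f hxy
  have hF : IsClosed {y : Y | α ≤ ν₀ y} := iotaOrdEpsTau_upperSemicontinuousLE d p k₀ Y hY hd f α
  -- KEY at the points of dimension `≤ 3`
  have key : ∀ y : Y, ringKrullDim (Y.presheaf.stalk y) ≤ 3 → ν₀ y = α →
      ∃ η : Y, η ⤳ y ∧ ν₀ η = α ∧ (∀ θ : Y, θ ⤳ η → θ ≠ η → ν₀ θ ≠ α) ∧
      cyl y = ρ η ∧ (∀ x : Y, x ⤳ y → ν₀ x = α → η ⤳ x) := by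
    intro y hdim hνy
    have hytop : y ∈ (⊤ : Y.Opens) := trivial
    rw [← iSup_affineOpens_eq_top Y] at hytop
    obtain ⟨U, hy⟩ := Opens.mem_iSup.mp hytop
    letI algy := TopCat.Presheaf.algebra_section_stalk Y.presheaf (⟨y, hy⟩ : (U : Y.Opens))
    haveI hlocy : IsLocalization.AtPrime (Y.presheaf.stalk y) (U.2.primeIdealOf ⟨y, hy⟩).asIdeal :=
      U.2.isLocalization_stalk ⟨y, hy⟩
    haveI : IsRegularLocalRing (Y.presheaf.stalk y) := isRegularLocalRing_stalk_of_smooth_of_field hY y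
    obtain ⟨P, hP, hE⟩ := exists_topStratum_iotaOrdEpsTau_eq (Y.presheaf.stalk y) hdim ((Y.presheaf.germ ⊤ y trivial) f)
    have hcylP : cyl y = ι (Localization.AtPrime P) (algebraMap (Y.presheaf.stalk y) (Localization.AtPrime P)
        ((Y.presheaf.germ ⊤ y trivial) f)) := iotaCylinder_eq_of_topStratum_eq iotaOrdEpsTau ι _ _ hE
    have hmemE : ∀ Q : PrimeSpectrum (Y.presheaf.stalk y),
        iotaOrdEpsTau (Localization.AtPrime Q.asIdeal) (algebraMap (Y.presheaf.stalk y) (Localization.AtPrime Q.asIdeal)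
          ((Y.presheaf.germ ⊤ y trivial) f)) = α ↔ P ≤ Q.asIdeal := by
      intro Q
      have h := Set.ext_iff.mp hE Q
      rw [ContactCylinder.mem_topStratum_iff, Set.mem_setOf_eq] at h
      rw [← h]
      change _ = α ↔ _ = ν₀ y
      rw [hνy]
    set q : PrimeSpectrum Γ(Y, U) := ⟨P.comap (algebraMap Γ(Y, U) (Y.presheaf.stalk y)), inferInstance⟩ with hq
    have hqle : q.asIdeal ≤ (U.2.primeIdealOf ⟨y, hy⟩).asIdeal :=
      comap_le_of_isLocalization_atPrime (U.2.primeIdealOf ⟨y, hy⟩).asIdeal (Y.presheaf.stalk y) P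
    have hηU : U.2.fromSpec q ∈ (U : Y.Opens) := fromSpec_mem U q
    have hpη : U.2.primeIdealOf ⟨U.2.fromSpec q, hηU⟩ = q := primeIdealOf_fromSpec U q hηU
    have hηy : U.2.fromSpec q ⤳ y := (GenerizationClosed.le_primeIdealOf_iff_specializes U hy q).mp hqle
    have htransη : ∀ (P' : (R : Type) → [CommRing R] → R → Prop),
        (∀ (R T : Type) [CommRing R] [CommRing T] (e : R ≃+* T) (g : R), P' R g ↔ P' T (e g)) →
        (P' (Localization.AtPrime P) (algebraMap (Y.presheaf.stalk y) (Localization.AtPrime P)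
            ((Y.presheaf.germ ⊤ y trivial) f)) ↔
          P' (Y.presheaf.stalk (U.2.fromSpec q)) ((Y.presheaf.germ ⊤ (U.2.fromSpec q) trivial) f)) := fun P' hP' =>
      GenerizationClosed.localization_stalk_iff P' U hP' f hy ⟨P, hP⟩ hηU (U.2.isLocalization_stalk' q hηU)
    refine ⟨U.2.fromSpec q, hηy, ?_, ?_, ?_, ?_⟩
    · exact (htransη (fun R _ g => iotaOrdEpsTau R g = α)
        (fun R T _ _ e g => by rw [iotaOrdEpsTau_isoInvariant R T e g])).mp ((hmemE ⟨P, hP⟩).mpr le_rfl)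
    · intro θ hθη hne
      have hθU : θ ∈ (U : Y.Opens) := hθη.mem_open U.1.isOpen hηU
      obtain ⟨Q, hQcomap, htransθ⟩ := GenerizationClosed.exists_prime_of_specializes U f hy hθU (hθη.trans hηy)
      have hθq : (U.2.primeIdealOf ⟨θ, hθU⟩).asIdeal ≤ q.asIdeal := by
        have h := primeIdealOf_le_of_specializes U hηU hθU hθη
        rwa [hpη] at h
      have hQP : Q.asIdeal ≤ P := by
        have h1 := IsLocalization.map_under (M := (U.2.primeIdealOf ⟨y, hy⟩).asIdeal.primeCompl) (Y.presheaf.stalk y) Q.asIdeal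
        have h2 := IsLocalization.map_under (M := (U.2.primeIdealOf ⟨y, hy⟩).asIdeal.primeCompl) (Y.presheaf.stalk y) P
        rw [Ideal.under_def] at h1 h2
        rw [← h1, ← h2]
        exact Ideal.map_mono (hQcomap.symm ▸ hθq)
      have hQne : Q.asIdeal ≠ P := by
        intro heq
        apply hne
        have h1 : (U.2.primeIdealOf ⟨θ, hθU⟩).asIdeal = q.asIdeal := by rw [← hQcomap, heq]
        have h2 : U.2.primeIdealOf ⟨θ, hθU⟩ = U.2.primeIdealOf ⟨U.2.fromSpec q, hηU⟩ := by
          rw [hpη]; exact PrimeSpectrum.ext h1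
        have h3 := U.2.fromSpec_primeIdealOf ⟨θ, hθU⟩
        rw [h2, U.2.fromSpec_primeIdealOf] at h3
        exact h3.symm
      have hnot : ¬ P ≤ Q.asIdeal := fun hle => hQne (le_antisymm hQP hle)
      intro hνθ
      apply hnot
      exact (hmemE Q).mp ((htransθ (fun R _ g => iotaOrdEpsTau R g = α)
        (fun R T _ _ e g => by rw [iotaOrdEpsTau_isoInvariant R T e g])).mpr hνθ)
    · rw [hcylP]
      exact (htransη (fun R _ g => ι R g = ρ (U.2.fromSpec q)) (fun R T _ _ e g => by rw [hiso R T e g])).mpr rfl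
    · intro x hxy hνx
      have hxU : x ∈ (U : Y.Opens) := hxy.mem_open U.1.isOpen hy
      obtain ⟨Q, hQcomap, htransx⟩ := GenerizationClosed.exists_prime_of_specializes U f hy hxU hxy
      have hPQ : P ≤ Q.asIdeal := (hmemE Q).mp ((htransx (fun R _ g => iotaOrdEpsTau R g = α)
        (fun R T _ _ e g => by rw [iotaOrdEpsTau_isoInvariant R T e g])).mpr hνx)
      have hqx : q.asIdeal ≤ (U.2.primeIdealOf ⟨x, hxU⟩).asIdeal := by
        rw [← hQcomap]; exact Ideal.comap_mono hPQ
      exact (GenerizationClosed.le_primeIdealOf_iff_specializes U hxU q).mp hqx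
  -- the closed set
  set M : Set Y := {x : Y | x ∈ {y : Y | α ≤ ν₀ y} ∧ ∀ x' ∈ {y : Y | α ≤ ν₀ y}, x' ⤳ x → x' = x} with hM
  have hMfin : M.Finite := TieFinite.finite_setOf_isMaximalIn hF
  set Mβ : Set Y := {x : Y | x ∈ M ∧ ν₀ x = α ∧ β ≤ ρ x} with hMβ
  have hMβfin : Mβ.Finite := hMfin.subset fun x hx => hx.1
  refine ⟨⋃ x ∈ Mβ, closure {x}, hMβfin.isClosed_biUnion fun _ _ => isClosed_closure, fun y hdim => ?_⟩
  constructor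
  · rintro ⟨hνy, hβ⟩
    refine ⟨hνy, ?_⟩
    obtain ⟨η, hηy, hνη, hmaxη, hcylη, -⟩ := key y hdim hνy
    refine Set.mem_iUnion₂.mpr ⟨η, ⟨⟨show α ≤ ν₀ η from le_of_eq hνη.symm, fun x' hx' hx'η => ?_⟩, hνη, ?_⟩,
      specializes_iff_mem_closure.mp hηy⟩
    · by_contra hne
      have hle : ν₀ x' ≤ α := hνη ▸ hmono hx'η
      exact hmaxη x' hx'η hne (le_antisymm hle hx')
    · show β ≤ ρ η
      rw [← hcylη]; exact hβ
  · rintro ⟨hνy, hyC⟩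
    refine ⟨hνy, ?_⟩
    obtain ⟨x, hxMβ, hyx⟩ := Set.mem_iUnion₂.mp hyC
    have hxy : x ⤳ y := specializes_iff_mem_closure.mpr hyx
    obtain ⟨η, -, hνη, -, hcylη, hbelow⟩ := key y hdim hνy
    have hηx : η ⤳ x := hbelow x hxy hxMβ.2.1
    have hηeq : η = x := hxMβ.1.2 η (show α ≤ ν₀ η from le_of_eq hνη.symm) hηx
    show β ≤ cyl y
    rw [hcylη, hηeq]
    exact hxMβ.2.2

end CylinderTrace

/-- **THE GRADED CLAUSE hgr, UNCONDITIONAL**: `IotaUpperSemicontinuousGradedLE 3 p Iota3.iotaFlatT` for every `p`.  See the module docstring.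
[OURS · hgr CLOSED] -/
theorem iotaFlatT_upperSemicontinuousGradedLE_three (p : ℕ) : IotaUpperSemicontinuousGradedLE 3 p iotaFlatT := by
  intro k₀ _ _ _ A _ _ _ j 𝒜 _ _ hdim f _ α
  classical
  -- `Y = Spec A`, smooth and quasi-compact over `k₀`
  let R : CommRingCat.{0} := CommRingCat.of A
  let hY : Spec R ⟶ Spec (CommRingCat.of k₀) := Spec.map (CommRingCat.ofHom (algebraMap k₀ A))
  haveI : Smooth hY := by
    rw [HasRingHomProperty.Spec_iff (P := @Smooth)]
    show RingHom.Smooth (algebraMap k₀ A)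
    exact RingHom.smooth_algebraMap.mpr inferInstance
  haveI : QuasiCompact hY := HasAffineProperty.iff_of_isAffine.mpr (inferInstance : CompactSpace _)
  let f' : Γ(Spec R, ⊤) := (Scheme.ΓSpecIso R).inv f
  -- stalks of `Spec A` are the localisations
  have hbridge : ∀ (ι' : (R : Type) → [CommRing R] → R → Ordinal.{0}), IotaIsoInvariant ι' → ∀ y : ↥(Spec R),
      ι' ((Spec R).presheaf.stalk y) ((Spec R).presheaf.germ ⊤ y trivial f') =
        ι' (Localization.AtPrime y.asIdeal) (algebraMap A (Localization.AtPrime y.asIdeal) f) := by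
    intro ι' h6 y
    have hg : (Spec R).presheaf.germ ⊤ y trivial f' =
        (Spec.stalkIso R y).inv (algebraMap A (Localization.AtPrime y.asIdeal) f) := by
      have h := CategoryTheory.ConcreteCategory.congr_hom (Spec.algebraMap_stalkIso_inv (R := R) y) f
      simp only [CategoryTheory.ConcreteCategory.comp_apply] at h
      exact h.symm
    rw [hg]
    exact h6 _ _ (Spec.stalkIso R y).symm.commRingCatIsoToRingEquiv (algebraMap A _ f)
  have hdimy : ∀ y : ↥(Spec R), ringKrullDim ((Spec R).presheaf.stalk y) = ringKrullDim (Localization.AtPrime y.asIdeal) :=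
    fun y => ringKrullDim_eq_of_ringEquiv (Spec.stalkIso R y).commRingCatIsoToRingEquiv
  -- a uniform bound on the dimensions of the stalks
  obtain ⟨d, hdA⟩ := exists_nat_ringKrullDim_le k₀ A
  have hd : ∀ y : ↥(Spec R), ringKrullDim ((Spec R).presheaf.stalk y) ≤ d := fun y => by
    rw [hdimy]; exact (ringKrullDim_localization_atPrime_le _).trans hdA
  -- the lexicographic decomposition `α = Λ·a + b`
  set Λ : Ordinal.{0} := (Ordinal.omega0 + 1) * Ordinal.omega0 with hΛdef
  have hΛ : Λ ≠ 0 := mul_ne_zero (fun h => one_ne_zero (Ordinal.add_eq_zero_iff.mp h).2) Ordinal.omega0_ne_zero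
  set a : Ordinal.{0} := α / Λ with ha
  set b : Ordinal.{0} := α % Λ with hb_def
  have hγ : α = Λ * a + b := (Ordinal.div_add_mod α Λ).symm
  have hbΛ : b < Λ := Ordinal.mod_lt α hΛ
  have hbcyl := iotaBoundedBy_iotaCylinder (ι₀ := iotaOrdEpsTau) iotaSigma_boundedBy
  -- the closed sets on `Spec A`
  obtain ⟨C, hC, hCiff⟩ := exists_isClosed_cylinder_trace iotaSigma iotaSigma_isoInvariant hY hd f' a b
  have hA1 : IsClosed {y : ↥(Spec R) | a + 1 ≤ iotaOrdEpsTau ((Spec R).presheaf.stalk y) ((Spec R).presheaf.germ ⊤ y trivial f')} :=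
    iotaOrdEpsTau_upperSemicontinuousLE d p k₀ (Spec R) hY hd f' (a + 1)
  have hA0 : IsClosed {y : ↥(Spec R) | a ≤ iotaOrdEpsTau ((Spec R).presheaf.stalk y) ((Spec R).presheaf.germ ⊤ y trivial f')} :=
    iotaOrdEpsTau_upperSemicontinuousLE d p k₀ (Spec R) hY hd f' a
  have hS : IsClosed ({y : ↥(Spec R) | a + 1 ≤ iotaOrdEpsTau ((Spec R).presheaf.stalk y) ((Spec R).presheaf.germ ⊤ y trivial f')} ∪
      ({y : ↥(Spec R) | a ≤ iotaOrdEpsTau ((Spec R).presheaf.stalk y) ((Spec R).presheaf.germ ⊤ y trivial f')} ∩ C)) :=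
    hA1.union (hA0.inter hC)
  -- the super-level set of `ι₃ᵗ` on the homogeneous primes is the trace of that closed set
  have hset : {P : {P : PrimeSpectrum A // P.asIdeal.IsHomogeneous 𝒜} |
      α ≤ iotaFlatT (Localization.AtPrime P.1.asIdeal) (algebraMap A (Localization.AtPrime P.1.asIdeal) f)} =
      Subtype.val ⁻¹'
        ({y : ↥(Spec R) | a + 1 ≤ iotaOrdEpsTau ((Spec R).presheaf.stalk y) ((Spec R).presheaf.germ ⊤ y trivial f')} ∪
          ({y : ↥(Spec R) | a ≤ iotaOrdEpsTau ((Spec R).presheaf.stalk y) ((Spec R).presheaf.germ ⊤ y trivial f')} ∩ C)) := by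
    ext ⟨P, hP⟩
    have h3 : ringKrullDim ((Spec R).presheaf.stalk P) ≤ 3 := by rw [hdimy]; exact hdim P hP
    have hiff := hCiff P h3
    constructor
    · intro h
      have h' : α ≤ iotaFlatT ((Spec R).presheaf.stalk P) ((Spec R).presheaf.germ ⊤ P trivial f') := by
        rw [hbridge iotaFlatT iotaFlatT_isoInvariant P]; exact h
      rw [iotaFlatT_apply, hγ, lexPair_le_iff hbΛ (hbcyl _ _)] at h'
      rcases h' with hlt | ⟨heq, hle⟩
      · exact Or.inl (Order.add_one_le_iff.mpr hlt)
      · exact Or.inr ⟨le_of_eq heq, (hiff.mp ⟨heq.symm, hle⟩).2⟩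
    · intro h
      have h' : α ≤ iotaFlatT ((Spec R).presheaf.stalk P) ((Spec R).presheaf.germ ⊤ P trivial f') := by
        rw [iotaFlatT_apply, hγ, lexPair_le_iff hbΛ (hbcyl _ _)]
        rcases h with h1 | ⟨h0, hC'⟩
        · exact Or.inl (Order.add_one_le_iff.mp h1)
        · have h0' : a ≤ iotaOrdEpsTau ((Spec R).presheaf.stalk P) ((Spec R).presheaf.germ ⊤ P trivial f') := h0
          rcases h0'.lt_or_eq with hlt | heq
          · exact Or.inl hlt
          · exact Or.inr ⟨heq, (hiff.mpr ⟨heq.symm, hC'⟩).2⟩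
      have h'' : α ≤ iotaFlatT (Localization.AtPrime P.asIdeal) (algebraMap A (Localization.AtPrime P.asIdeal) f) := by
        rw [← hbridge iotaFlatT iotaFlatT_isoInvariant P]; exact h'
      exact h''
  rw [hset]
  exact hS.preimage continuous_subtype_val

end Iota3

/-! ## The gap list of the registered stub after this file -/

open Iota3 Polynomial in
/-- **P3 RUNG FOR THE NAMED PAIR MODULO THE GAP LIST AFTER THIS FILE** (`keyRungGrHomLE_three_of_descent` with hgr DISCHARGED by
`Iota3.iotaFlatT_upperSemicontinuousGradedLE_three`): (desc-τ), `hσ`, (σ-pt), (hpt), hgame, the residue of the dominance word at the power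
positions. [OURS · audit glue] -/
theorem keyRungGrHomLE_three_of_descent' (p : ℕ)
    (hD : ∀ (T T' : Type) [CommRing T] [IsRegularLocalRing T] [CommRing T'] [IsRegularLocalRing T'] [Algebra T T']
      [IsLocalHom (algebraMap T T')] [Algebra.FormallySmooth T T'] [Algebra.EssFiniteType T T'] (g : T),
      ringKrullDim T' ≤ 3 → IsTiePosition T' (algebraMap T T' g) → IsTiePosition T g)
    (hσ : ∀ (T : Type) [CommRing T] [IsRegularLocalRing T] (g : T)
      [((maximalIdeal T).map (C : T →+* T[X])).IsPrime], ringKrullDim T ≤ 3 →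
      iotaSigma (Localization.AtPrime ((maximalIdeal T).map (C : T →+* T[X])))
        (algebraMap T[X] (Localization.AtPrime ((maximalIdeal T).map (C : T →+* T[X]))) (C g)) ≤ iotaSigma T g)
    (hσpt : ∀ (T T' : Type) [CommRing T] [IsRegularLocalRing T] [CommRing T'] [IsRegularLocalRing T'] [Algebra T T']
      [IsLocalHom (algebraMap T T')] [Algebra.FormallySmooth T T'] [Algebra.EssFiniteType T T'] (g : T) (𝔮' : Ideal T')
      [𝔮'.IsPrime], ringKrullDim T' ≤ 3 →
      iotaSigma (Localization.AtPrime 𝔮') (algebraMap T (Localization.AtPrime 𝔮') g) =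
        iotaSigma (Localization.AtPrime (𝔮'.comap (algebraMap T T')))
          (algebraMap T (Localization.AtPrime (𝔮'.comap (algebraMap T T'))) g))
    (hpt : ∀ (T T' : Type) [CommRing T] [IsRegularLocalRing T] [CommRing T'] [IsRegularLocalRing T'] [Algebra T T']
      [IsLocalHom (algebraMap T T')] [Algebra.FormallySmooth T T'] [Algebra.EssFiniteType T T'] (g : T),
      ringKrullDim T' ≤ 3 → (maximalIdeal T).map (algebraMap T T') = maximalIdeal T' → ringKrullDim T = (3 : ℕ) →
      ∀ m : ℕ, jFlatCoreE T' (algebraMap T T' g) m = (jFlatCoreE T g m).map (algebraMap T T'))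
    (hgame : CanonicalGameClauseHomLE 3 p iotaFlatT jFlatT)
    (hres : ∀ (k₀ : Type) [Field k₀] [CharP k₀ p] [PerfectField k₀]
      (S : Type) [CommRing S] [Algebra k₀ S] [Algebra.EssFiniteType k₀ S] [IsRegularLocalRing S] (f : S),
      ringKrullDim S = (3 : ℕ) → f ≠ 0 → f ∈ (maximalIdeal S) ^ 2 →
      ContactCylinder.topStratumPrime iotaOrdEpsTau S f = maximalIdeal S → iotaEps S f ≠ 1 →
      (∃ ℓ ∈ maximalIdeal S, f ∈ Ideal.span {ℓ ^ (adicOrder f).toNat} ⊔ maximalIdeal S ^ ((adicOrder f).toNat + 1)) →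
      ∀ (a b : ℕ), 0 < b →
      (∀ q' r₁' r₂' : ℕ, AdmissibleTriple q' r₁' r₂' → FlagReaches f (adicOrder f).toNat q' r₁' r₂' → r₁' * b ≤ a * r₂') →
      ∀ (g₁ g₂ g₁' g₂' : S) (q r₁ r₂ : ℕ), AdmissibleTriple q r₁ r₂ → r₁ * b = a * r₂ → q < r₂ → r₂ < r₁ →
        IsTwoFlag g₁ g₂ → IsTwoFlag g₁' g₂' →
        f ∈ flagContactFiltration g₁ g₂ q r₁ r₂ (r₁ * (adicOrder f).toNat) →
        f ∈ flagContactFiltration g₁' g₂' q r₁ r₂ (r₁ * (adicOrder f).toNat) →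
        g₂' ∈ flagContactFiltration g₁ g₂ q r₁ r₂ r₂) :
    KeyRungGrHomLE 3 p :=
  keyRungGrHomLE_three_of_descent p hD hσ hσpt hpt hgame hres (iotaFlatT_upperSemicontinuousGradedLE_three p)

end Summit.ResolutionOfSingularities.ResolutionOfSingularities.Cruxes.HypersurfaceCentreConstruction.LocalEngine

end
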